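import Literature.Geometry.Riemannian.BarrierMaximumPrinciple
import Literature.Geometry.Riemannian.DistanceGradientEikonal
import Literature.Geometry.Riemannian.HopfRinowHeineBorel
import Mathlib.Analysis.SpecialFunctions.ExpDeriv
import HarnessLib

/-!
# The strong maximum principle for viscosity subharmonic functions (E. Hopf; Calabi 1958)

E. Calabi, *An extension of E. Hopf's maximum principle with an application to Riemannian
geometry*, Duke Math. J. 25 (1958) 45–56, Thm. 1–2: a (weakly, in the barrier / viscosity
sense) subharmonic function which attains its maximum is constant. We PROVE it
(`eq_of_isMaxOn_of_viscosity_subharmonic`) for continuous `u` on a connected Riemannian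
`m`-manifold with complete Levi-Civita connection and `Ric ≥ -(m-1)`, in the viscosity form:
"for every `x` and every `C²` function `φ` touching `u` from above at `x`, `Δφ(x) ≥ 0`".
Proof (E. Hopf's, with Calabi's barriers in place of smoothness of the distance function): if
`u < M = max u` somewhere, pick `y` with `u(y) < M`, let `R = d(y, {u = M}) > 0` be attained at
`x₁`; the bump `h = e^{-α d_y²} - e^{-α R²}` has, for `α` large, `C²` lower barriers with
`Δ ≥ c₀ > 0` at every point of the shell `R/2 ≤ d_y ≤ 3R/2` (Calabi barriers
`exists_smooth_upper_barrier_edist`, eikonal equation, `Δ d ≤ (m-1) coth`); the barrier maximum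
principle (`le_of_upper_barriers`) on `{R/2 ≤ d_y ≤ R}` gives `u + δh ≤ M` there for small
`δ > 0`, and `u + δh < M` where `d_y > R`; so the constant `M` touches the strict viscosity
subsolution `u + δh` from above at the interior point `x₁`: `0 = ΔM ≥ δ c₀ > 0`.
No definitions, no named facts (D-0026). Groundwork for `CheegerColding1997_sphereStability`.

## References

* E. Calabi, Duke Math. J. 25 (1958) 45–56, Thms. 1–2. [Calabi1958]
* E. Hopf, Sitzungsber. Preuss. Akad. Wiss. 19 (1927) 147–152; D. Gilbarg, N. Trudinger,
  *Elliptic PDE of second order*, Lemma 3.4, Thm. 3.5.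
* J. Cheeger, T. H. Colding, Ann. of Math. 144 (1996), §1 (Laplacian comparison in the barrier
  sense). [CheegerColding1996]
-/

noncomputable section

open Bundle Set Function Filter
open scoped Manifold ContDiff Topology ENNReal NNReal Real

namespace Literature.Geometry.Riemannian

open Lorentzian Lorentzian.PseudoRiemannianMetric

variable {E : Type*} [NormedAddCommGroup E] [NormedSpace ℝ E] [FiniteDimensional ℝ E]
  [CompleteSpace E] {M : Type*} [TopologicalSpace M] [ChartedSpace E M] [IsManifold 𝓘(ℝ, E) ∞ M]
  [T2Space M]
  (g : PseudoRiemannianMetric 𝓘(ℝ, E) ∞ E (TangentSpace 𝓘(ℝ, E) : M → Type _)) [g.HasLeviCivita]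
  [CovariantDerivative.ContMDiffCovariantDerivative g.leviCivita 1]
  [CovariantDerivative.ContMDiffCovariantDerivative g.leviCivita ∞]

/-! ### §0 Helpers -/

omit [T2Space M] [CovariantDerivative.ContMDiffCovariantDerivative g.leviCivita 1]
  [CovariantDerivative.ContMDiffCovariantDerivative g.leviCivita ∞] in
/-- `Δ_g c = 0` for a constant (as `ζ ∘ u` with `ζ ≡ c`, `dalembertian_real_comp`). [folklore] -/
theorem laplaceBeltrami_const' (c : ℝ) (x : M) : g.laplaceBeltrami (fun _ : M ↦ c) x = 0 := by
  rw [laplaceBeltrami_eq_dalembertian]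
  have h := g.dalembertian_real_comp (u := fun _ : M ↦ (0 : ℝ)) (ζ := fun _ : ℝ ↦ c) (x := x)
    contMDiffAt_const contDiffAt_const
  simp only [deriv_const', deriv_const, zero_mul, add_zero] at h
  exact h

/-- **`|∇ d(q,·)|² = 1` wherever `d(q,·)` is differentiable** (`x ≠ q`): `≤ 1` by
`gradSq_edist_le_one`, `≥ 1` by the radial derivative along a minimal geodesic from `q`
(`mvfderiv_edist_velocity_eq_one`). [cite: LeeRiemannianManifolds2018, Thm. 6.34] -/
theorem gradSq_edist_eq_one_of_mdifferentiableAt [ConnectedSpace M] (hg : g.IsRiemannian)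
    (hc : IsGeodesicallyComplete g.leviCivita) {q x : M} (hxq : x ≠ q)
    (hd : MDifferentiableAt 𝓘(ℝ, E) 𝓘(ℝ, ℝ) (fun z ↦ (g.edist hg q z).toReal) x) :
    g.gradSq (fun z ↦ (g.edist hg q z).toReal) x = 1 := by
  refine le_antisymm (gradSq_edist_le_one g hg hc q hd) ?_
  obtain ⟨u, T, hu, hT, -, hx⟩ := exists_unit_speed_expMap_eq_of_ne g hg hc hxq
  subst hx
  -- a minimizing geodesic from `q` (`exists_isMinimizingUpTo_of_isGeodesicallyComplete`)
  haveI : LocallyCompactSpace M := Manifold.locallyCompact_of_finiteDimensional 𝓘(ℝ, E)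
  haveI : RegularSpace M := inferInstance
  obtain ⟨v, hmin, hv⟩ := exists_isMinimizingUpTo_of_isGeodesicallyComplete g le_rfl hg hc q
    (expMap g.leviCivita q (T • u))
  -- `v ≠ 0`, write `v = S w`, `w` unit
  have hvv : 0 < g.val q v v := by
    refine hg q v fun h0 ↦ hxq ?_
    rw [← hv, h0]; exact expMap_zero (cov := g.leviCivita) q
  set S : ℝ := Real.sqrt (g.val q v v) with hS_def
  have hS : 0 < S := Real.sqrt_pos.2 hvv
  set w : TangentSpace 𝓘(ℝ, E) q := S⁻¹ • v with hw_def
  have hw : g.val q w w = 1 := by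
    simp only [hw_def, map_smul, FunLike.coe_smul, Pi.smul_apply, smul_eq_mul]
    rw [← mul_assoc, ← mul_inv, show S * S = g.val q v v by rw [hS_def, Real.mul_self_sqrt hvv.le],
      inv_mul_cancel₀ hvv.ne']
  have hvSw : v = S • w := by rw [hw_def, smul_smul, mul_inv_cancel₀ hS.ne', one_smul]
  have hminw : IsMinimizingUpTo g hg q w S := by
    rw [hvSw, isMinimizingUpTo_smul_iff hg hc q w hS, mul_one] at hmin; exact hmin
  have hxw : expMap g.leviCivita q (S • w) = expMap g.leviCivita q (T • u) := by rw [← hvSw]; exact hv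
  have hd' : MDifferentiableAt 𝓘(ℝ, E) 𝓘(ℝ, ℝ) (fun z ↦ (g.edist hg q z).toReal)
      (expMap g.leviCivita q (S • w)) := by rw [hxw]; exact hd
  have hrad := mvfderiv_edist_velocity_eq_one g hg hc q w hw hS hminw hd'
  have hspeed : g.val (expMap g.leviCivita q (S • w))
      (velocity 𝓘(ℝ, E) (fun σ ↦ expMap g.leviCivita q (σ • w)) S)
      (velocity 𝓘(ℝ, E) (fun σ ↦ expMap g.leviCivita q (σ • w)) S) = 1 := by
    rw [val_velocity_expMap_smul g hc q w S, hw]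
  have hCS := abs_mvfderiv_le_sqrt_gradSq_mul_sqrt g hg (fun z ↦ (g.edist hg q z).toReal)
    (expMap g.leviCivita q (S • w)) (velocity 𝓘(ℝ, E) (fun σ ↦ expMap g.leviCivita q (σ • w)) S)
  rw [hrad, hspeed, Real.sqrt_one, mul_one, abs_one] at hCS
  rw [← hxw]
  have hnn : 0 ≤ g.gradSq (fun z ↦ (g.edist hg q z).toReal) (expMap g.leviCivita q (S • w)) := by
    by_contra hneg
    rw [not_le] at hneg
    rw [Real.sqrt_eq_zero'.2 hneg.le] at hCS
    linarith
  calc (1 : ℝ) = 1 ^ 2 := by norm_num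
    _ ≤ Real.sqrt (g.gradSq (fun z ↦ (g.edist hg q z).toReal) (expMap g.leviCivita q (S • w))) ^ 2 := by
        gcongr
    _ = _ := Real.sq_sqrt hnn

/-! ### §1 Hopf's bump function and its lower barriers -/

section Bump

variable {E : Type*} [NormedAddCommGroup E] [NormedSpace ℝ E] [FiniteDimensional ℝ E]
  [CompleteSpace E] {M : Type*} [TopologicalSpace M] [ChartedSpace E M] [IsManifold 𝓘(ℝ, E) ∞ M]
  [T2Space M]
  (g : PseudoRiemannianMetric 𝓘(ℝ, E) ∞ E (TangentSpace 𝓘(ℝ, E) : M → Type _)) [g.HasLeviCivita]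
  [CovariantDerivative.ContMDiffCovariantDerivative g.leviCivita 1]
  [CovariantDerivative.ContMDiffCovariantDerivative g.leviCivita ∞]

/-- The derivatives of `t ↦ exp(-α (ε + t)²)`. [folklore] -/
theorem hasDerivAt_exp_neg_mul_sq (α ε t : ℝ) :
    HasDerivAt (fun t : ℝ ↦ Real.exp (-(α * (ε + t) ^ 2)))
      (Real.exp (-(α * (ε + t) ^ 2)) * (-(2 * α * (ε + t)))) t := by
  have h1 : HasDerivAt (fun t : ℝ ↦ -(α * (ε + t) ^ 2)) (-(2 * α * (ε + t))) t := by
    have h2 : HasDerivAt (fun t : ℝ ↦ ε + t) 1 t := (hasDerivAt_id t).const_add ε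
    have h3 := (h2.pow 2).const_mul α
    exact h3.neg.congr_deriv (by norm_num; ring)
  exact h1.exp
set_option maxHeartbeats 400000 in -- buildfix (bf3-g26): 160k/180k FAIL, 200k PASS at accept time; line-neutral budget line
/-- **Lower barriers for Hopf's bump** `h = e^{-α d_y²} - e^{-α R²}` on the shell
`R/2 ≤ d_y ≤ 3R/2`, with `Δ ≥ α e^{-9αR²/4} > 0`, for
`α R² ≥ 3 + 3R(m-1) coth(R/4)` (Calabi's smooth upper barriers of `d_y` composed with the
decreasing convex profile; eikonal equation and `Δ d ≤ (m-1) coth`).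
[cite: Calabi1958, Thm. 1 (proof)] -/
theorem exists_lower_barrier_hopf_bump [ConnectedSpace M] (hg : g.IsRiemannian)
    (hc : IsGeodesicallyComplete g.leviCivita)
    (hRic : ∀ (x : M) (w : TangentSpace 𝓘(ℝ, E) x),
      -((Module.finrank ℝ E : ℝ) - 1) * g.val x w w ≤ g.leviCivita.ricci x w w)
    (y : M) {R α : ℝ} (hR : 0 < R)
    (hα : 3 + 3 * R * ((Module.finrank ℝ E : ℝ) - 1) * (Real.cosh (R / 4) / Real.sinh (R / 4)) ≤ α * R ^ 2)
    {x : M} (hx1 : R / 2 ≤ (g.edist hg y x).toReal) (hx2 : (g.edist hg y x).toReal ≤ 3 * R / 2) :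
    ∃ ψ : M → ℝ, (∀ᶠ x' in 𝓝 x, ContMDiffAt 𝓘(ℝ, E) 𝓘(ℝ, ℝ) 2 ψ x') ∧
      (∀ z, ψ z ≤ Real.exp (-(α * (g.edist hg y z).toReal ^ 2)) - Real.exp (-(α * R ^ 2))) ∧
      ψ x = Real.exp (-(α * (g.edist hg y x).toReal ^ 2)) - Real.exp (-(α * R ^ 2)) ∧
      α * Real.exp (-(α * (9 * R ^ 2 / 4))) ≤ g.laplaceBeltrami ψ x := by
  haveI : LocallyCompactSpace M := Manifold.locallyCompact_of_finiteDimensional 𝓘(ℝ, E)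
  haveI : RegularSpace M := inferInstance
  set d : ℝ := (g.edist hg y x).toReal with hd_def
  have hd0 : 0 < d := by linarith
  have hxy : x ≠ y := by
    intro h; rw [h, PseudoRiemannianMetric.edist_self, ENNReal.toReal_zero] at hd_def; linarith
  -- the dimension factor and the size of `α`
  have hm : (0 : ℝ) ≤ (Module.finrank ℝ E : ℝ) - 1 := by
    obtain ⟨u₀, -, hu₀, -, -, -⟩ := exists_unit_speed_expMap_eq_of_ne g hg hc hxy
    have hu₀0 : (u₀ : E) ≠ 0 := fun h ↦ by
      rw [h, map_zero] at hu₀; exact zero_ne_one hu₀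
    have h1 : 0 < Module.finrank ℝ E := Module.finrank_pos_iff_exists_ne_zero.2 ⟨u₀, hu₀0⟩
    have : (1 : ℝ) ≤ (Module.finrank ℝ E : ℝ) := by exact_mod_cast h1
    linarith
  have hcoth0 : 0 ≤ Real.cosh (R / 4) / Real.sinh (R / 4) :=
    div_nonneg (Real.cosh_pos _).le (Real.sinh_nonneg_iff.2 (by linarith))
  have hα0 : 0 < α := by
    have h1 : 0 ≤ 3 * R * ((Module.finrank ℝ E : ℝ) - 1) * (Real.cosh (R / 4) / Real.sinh (R / 4)) := by
      positivity
    have h2 : 0 < α * R ^ 2 := by linarith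
    by_contra hle
    rw [not_lt] at hle
    nlinarith [mul_le_mul_of_nonneg_right hle (sq_nonneg R)]
  have hx1' : R / 2 ≤ d := hx1
  have hx2' : d ≤ 3 * R / 2 := hx2
  -- Calabi's barrier with `ε' = R/4`
  set ε' : ℝ := R / 4 with hε'
  have hε'0 : 0 < ε' := by positivity
  have hε'd : ε' < (g.edist hg y x).toReal := by rw [← hd_def]; linarith
  obtain ⟨q, -, hqx, htri, hsmooth, hΔ⟩ := exists_smooth_upper_barrier_edist g hg hc hRic hxy hε'0 hε'd
  rw [← hd_def] at hqx hΔ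
  have ht₀ : (g.edist hg q x).toReal = d - ε' := by rw [hqx, ENNReal.toReal_ofReal (by linarith)]
  have hxq : x ≠ q := by
    intro h; rw [h, PseudoRiemannianMetric.edist_self, ENNReal.toReal_zero] at ht₀; linarith
  -- the profile `η₂(t) = exp(-α(ε'+t)²) - exp(-αR²)` and `ψ = η₂ ∘ d_q`
  set η₂ : ℝ → ℝ := fun t ↦ Real.exp (-(α * (ε' + t) ^ 2)) - Real.exp (-(α * R ^ 2)) with hη₂
  have hη₂d : ∀ t, HasDerivAt η₂ (Real.exp (-(α * (ε' + t) ^ 2)) * (-(2 * α * (ε' + t)))) t :=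
    fun t ↦ (hasDerivAt_exp_neg_mul_sq α ε' t).sub_const (Real.exp (-(α * R ^ 2)))
  have hη₂' : deriv η₂ = fun t ↦ Real.exp (-(α * (ε' + t) ^ 2)) * (-(2 * α * (ε' + t))) :=
    funext fun t ↦ (hη₂d t).deriv
  have hη₂dd : ∀ t, HasDerivAt (deriv η₂)
      (Real.exp (-(α * (ε' + t) ^ 2)) * (-(2 * α * (ε' + t))) * (-(2 * α * (ε' + t))) +
        Real.exp (-(α * (ε' + t) ^ 2)) * (-(2 * α))) t := by
    intro t
    rw [hη₂']
    have h1 := hasDerivAt_exp_neg_mul_sq α ε' t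
    have h2 : HasDerivAt (fun t : ℝ ↦ -(2 * α * (ε' + t))) (-(2 * α)) t := by
      have := ((hasDerivAt_id t).const_add ε').const_mul (2 * α)
      exact this.neg.congr_deriv (by ring)
    exact h1.mul h2
  have hη₂smooth : ContDiff ℝ ∞ η₂ := by
    rw [hη₂]; fun_prop
  set ψ : M → ℝ := fun z ↦ η₂ ((g.edist hg q z).toReal) with hψ
  refine ⟨ψ, ?_, ?_, ?_, ?_⟩
  · -- `C²` near `x`
    filter_upwards [eventually_contMDiffAt_two_of_contMDiffAt hsmooth] with x' hx'
    exact ((hη₂smooth.of_le (WithTop.coe_le_coe.2 le_top)).contMDiff.contMDiffAt).comp x' hx'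
  · -- `ψ ≤ h`: `d_y ≤ ε' + d_q` and the profile is decreasing on `[0, ∞)`
    intro z
    have h1 : (g.edist hg y z).toReal ≤ ε' + (g.edist hg q z).toReal := by
      have h2 := ENNReal.toReal_mono (ENNReal.add_ne_top.2 ⟨ENNReal.ofReal_ne_top, edist_ne_top hg q z⟩)
        (htri z)
      rwa [ENNReal.toReal_add ENNReal.ofReal_ne_top (edist_ne_top hg q z), ENNReal.toReal_ofReal hε'0.le] at h2
    have h3 : 0 ≤ (g.edist hg y z).toReal := ENNReal.toReal_nonneg
    show Real.exp (-(α * (ε' + (g.edist hg q z).toReal) ^ 2)) - Real.exp (-(α * R ^ 2)) ≤ _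
    have h4 : (g.edist hg y z).toReal ^ 2 ≤ (ε' + (g.edist hg q z).toReal) ^ 2 :=
      pow_le_pow_left₀ h3 h1 2
    have h5 : Real.exp (-(α * (ε' + (g.edist hg q z).toReal) ^ 2)) ≤
        Real.exp (-(α * (g.edist hg y z).toReal ^ 2)) :=
      Real.exp_le_exp.2 (by nlinarith [hα0.le])
    linarith
  · -- `ψ x = h x`
    show Real.exp (-(α * (ε' + (g.edist hg q x).toReal) ^ 2)) - Real.exp (-(α * R ^ 2)) = _
    rw [ht₀, show ε' + (d - ε') = d by ring]
  · -- the Laplacian at `x`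
    have hsm2 : ContMDiffAt 𝓘(ℝ, E) 𝓘(ℝ, ℝ) 2 (fun z ↦ (g.edist hg q z).toReal) x :=
      hsmooth.of_le (WithTop.coe_le_coe.2 le_top)
    have heik := gradSq_edist_eq_one_of_mdifferentiableAt g hg hc hxq
      (hsmooth.mdifferentiableAt (by simp))
    rw [PseudoRiemannianMetric.gradSq] at heik
    have hcomp : g.laplaceBeltrami ψ x =
        deriv (deriv η₂) ((g.edist hg q x).toReal) +
          deriv η₂ ((g.edist hg q x).toReal) * g.laplaceBeltrami (fun z ↦ (g.edist hg q z).toReal) x := by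
      rw [laplaceBeltrami_eq_dalembertian, laplaceBeltrami_eq_dalembertian,
        show ψ = η₂ ∘ (fun z ↦ (g.edist hg q z).toReal) from rfl,
        g.dalembertian_real_comp hsm2 (hη₂smooth.contDiffAt.of_le (WithTop.coe_le_coe.2 le_top)),
        heik, mul_one]
    -- abbreviations
    set e : ℝ := Real.exp (-(α * d ^ 2)) with he
    have he0 : 0 < e := Real.exp_pos _
    have hd1 : deriv η₂ ((g.edist hg q x).toReal) = e * (-(2 * α * d)) := by
      rw [hη₂', ht₀]
      show Real.exp (-(α * (ε' + (d - ε')) ^ 2)) * (-(2 * α * (ε' + (d - ε')))) = _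
      rw [show ε' + (d - ε') = d by ring]
    have hd2 : deriv (deriv η₂) ((g.edist hg q x).toReal) =
        e * (-(2 * α * d)) * (-(2 * α * d)) + e * (-(2 * α)) := by
      rw [(hη₂dd _).deriv, ht₀, show ε' + (d - ε') = d by ring]
    rw [hcomp, hd1, hd2]
    set L : ℝ := g.laplaceBeltrami (fun z ↦ (g.edist hg q z).toReal) x with hL
    set C : ℝ := ((Module.finrank ℝ E : ℝ) - 1) * (Real.cosh (d - ε') / Real.sinh (d - ε')) with hC
    have hLC : L ≤ C := hΔ
    -- `coth(d - ε') ≤ coth(R/4)`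
    have hcoth : Real.cosh (d - ε') / Real.sinh (d - ε') ≤ Real.cosh (R / 4) / Real.sinh (R / 4) := by
      -- `coth` is nonincreasing on `(0, ∞)`
      have ha : 0 < R / 4 := by positivity
      have hab : R / 4 ≤ d - ε' := by rw [hε']; linarith
      have hsa : 0 < Real.sinh (R / 4) := Real.sinh_pos_iff.2 ha
      have hsb : 0 < Real.sinh (d - ε') := Real.sinh_pos_iff.2 (ha.trans_le hab)
      rw [div_le_div_iff₀ hsb hsa]
      have h : 0 ≤ Real.sinh (d - ε' - R / 4) := Real.sinh_nonneg_iff.2 (by linarith)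
      rw [Real.sinh_sub] at h
      linarith
    have hCb : C ≤ ((Module.finrank ℝ E : ℝ) - 1) * (Real.cosh (R / 4) / Real.sinh (R / 4)) :=
      mul_le_mul_of_nonneg_left hcoth hm
    have hC0 : 0 ≤ C := by
      rw [hC]; exact mul_nonneg hm (div_nonneg (Real.cosh_pos _).le
        (Real.sinh_nonneg_iff.2 (by rw [hε']; linarith)))
    -- the main inequality
    have hkey : e * (-(2 * α * d)) * (-(2 * α * d)) + e * (-(2 * α)) + e * (-(2 * α * d)) * L ≥
        e * α * (4 * α * d ^ 2 - 2 - 2 * d * C) := by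
      have h1 : e * (-(2 * α * d)) * L ≥ e * (-(2 * α * d)) * C := by
        have : e * (2 * α * d) * L ≤ e * (2 * α * d) * C :=
          mul_le_mul_of_nonneg_left hLC (by positivity)
        nlinarith
      nlinarith
    have hbracket : 1 ≤ 4 * α * d ^ 2 - 2 - 2 * d * C := by
      have h1 : α * R ^ 2 ≤ 4 * α * d ^ 2 := by
        have hRd : R ≤ 2 * d := by linarith
        have hsq : R ^ 2 ≤ (2 * d) ^ 2 := pow_le_pow_left₀ hR.le hRd 2
        nlinarith [mul_le_mul_of_nonneg_left hsq hα0.le]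
      have h2 : 2 * d * C ≤ 3 * R * (((Module.finrank ℝ E : ℝ) - 1) *
          (Real.cosh (R / 4) / Real.sinh (R / 4))) := by
        have h3 : 2 * d ≤ 3 * R := by linarith
        calc 2 * d * C ≤ 3 * R * C := mul_le_mul_of_nonneg_right h3 hC0
          _ ≤ _ := mul_le_mul_of_nonneg_left hCb (by linarith)
      have h4 : 3 * R * ((Module.finrank ℝ E : ℝ) - 1) * (Real.cosh (R / 4) / Real.sinh (R / 4)) =
          3 * R * (((Module.finrank ℝ E : ℝ) - 1) * (Real.cosh (R / 4) / Real.sinh (R / 4))) := by ring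
      linarith
    have hexp : Real.exp (-(α * (9 * R ^ 2 / 4))) ≤ e := by
      rw [he]
      refine Real.exp_le_exp.2 ?_
      have h1 : d ^ 2 ≤ (3 * R / 2) ^ 2 := pow_le_pow_left₀ hd0.le hx2' 2
      have h2 := mul_le_mul_of_nonneg_left h1 hα0.le
      linarith
    calc α * Real.exp (-(α * (9 * R ^ 2 / 4))) ≤ α * e := mul_le_mul_of_nonneg_left hexp hα0.le
      _ = e * α * 1 := by ring
      _ ≤ e * α * (4 * α * d ^ 2 - 2 - 2 * d * C) :=
          mul_le_mul_of_nonneg_left hbracket (by positivity)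
      _ ≤ _ := hkey

end Bump

/-! ### §2 The strong maximum principle -/

section SMP

variable {E : Type*} [NormedAddCommGroup E] [NormedSpace ℝ E] [FiniteDimensional ℝ E]
  [CompleteSpace E] {M : Type*} [TopologicalSpace M] [ChartedSpace E M] [IsManifold 𝓘(ℝ, E) ∞ M]
  [T2Space M]
  (g : PseudoRiemannianMetric 𝓘(ℝ, E) ∞ E (TangentSpace 𝓘(ℝ, E) : M → Type _)) [g.HasLeviCivita]
  [CovariantDerivative.ContMDiffCovariantDerivative g.leviCivita 1]
  [CovariantDerivative.ContMDiffCovariantDerivative g.leviCivita ∞]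
set_option maxHeartbeats 400000 in -- buildfix (bf3-g26): 160k/180k FAIL, 200k PASS at accept time; line-neutral budget line
/-- **The strong maximum principle (E. Hopf 1927; Calabi 1958, Thms. 1–2, for weakly subharmonic
functions).** On a connected Riemannian `m`-manifold with complete Levi-Civita connection and
`Ric ≥ -(m-1)`, let `u` be continuous and subharmonic in the viscosity (barrier) sense: for every
`x` and every `φ` of class `C²` near `x` with `u - φ` locally maximal at `x`, `Δφ(x) ≥ 0`. If `u`
attains its maximum, then `u` is constant. [cite: Calabi1958, Thm. 1, Thm. 2] -/
theorem eq_of_isMaxOn_of_viscosity_subharmonic [ConnectedSpace M] (hg : g.IsRiemannian)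
    (hc : IsGeodesicallyComplete g.leviCivita)
    (hRic : ∀ (x : M) (w : TangentSpace 𝓘(ℝ, E) x),
      -((Module.finrank ℝ E : ℝ) - 1) * g.val x w w ≤ g.leviCivita.ricci x w w)
    {u : M → ℝ} (hucont : Continuous u)
    (hsub : ∀ (x : M) (φ : M → ℝ), (∀ᶠ x' in 𝓝 x, ContMDiffAt 𝓘(ℝ, E) 𝓘(ℝ, ℝ) 2 φ x') →
      IsLocalMax (fun x' ↦ u x' - φ x') x → 0 ≤ g.laplaceBeltrami φ x)
    {x₀ : M} (hmax : ∀ x, u x ≤ u x₀) : ∀ x, u x = u x₀ := by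
  haveI : LocallyCompactSpace M := Manifold.locallyCompact_of_finiteDimensional 𝓘(ℝ, E)
  haveI : RegularSpace M := inferInstance
  set m : ℝ := u x₀ with hm_def
  by_contra hcon
  simp only [not_forall] at hcon
  obtain ⟨y, hy⟩ := hcon
  have hym : u y < m := lt_of_le_of_ne (hmax y) hy
  -- the distance from `y`
  set f : M → ℝ := fun z ↦ (g.edist hg y z).toReal with hf_def
  have hfcont : Continuous f :=
    ENNReal.continuousOn_toReal.comp_continuous
      ((PseudoRiemannianMetric.continuous_edist hg).comp (Continuous.prodMk_right y))
      fun z ↦ edist_ne_top hg y z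
  have hf0 : ∀ z, 0 ≤ f z := fun z ↦ ENNReal.toReal_nonneg
  have hfe : ∀ z, g.edist hg y z = ENNReal.ofReal (f z) := fun z ↦
    (ENNReal.ofReal_toReal (edist_ne_top hg y z)).symm
  -- closed balls about `y` are compact (Hopf–Rinow)
  have hcpt : ∀ r : ℝ, IsCompact {z | f z ≤ r} := by
    intro r
    by_cases hr : r < 0
    · have : {z | f z ≤ r} = ∅ := Set.eq_empty_of_forall_notMem fun z hz ↦ by
        have := hf0 z; simp only [mem_setOf_eq] at hz; linarith
      rw [this]; exact isCompact_empty
    rw [not_lt] at hr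
    have h := isCompact_setOf_edist_le g le_rfl hg hc y r.toNNReal
    convert h using 1
    ext z
    simp only [mem_setOf_eq]
    rw [hfe z, show ((r.toNNReal : ℝ≥0) : ℝ≥0∞) = ENNReal.ofReal r from rfl,
      ENNReal.ofReal_le_ofReal_iff hr]
  -- the nearest point `x₁` of `S = {u = m}` to `y`
  set S : Set M := {z | m ≤ u z} with hS
  have hSc : IsClosed S := isClosed_le continuous_const hucont
  obtain ⟨x₁, hx₁S', hx₁min⟩ := ((hcpt (f x₀)).inter_right hSc).exists_isMinOn
    ⟨x₀, show f x₀ ≤ f x₀ from le_rfl, show m ≤ u x₀ from le_rfl⟩ hfcont.continuousOn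
  obtain ⟨hx₁f, hx₁S⟩ := hx₁S'
  have hux₁ : u x₁ = m := le_antisymm (hmax x₁) hx₁S
  set R : ℝ := f x₁ with hR_def
  have hR : 0 < R := by
    rcases (hf0 x₁).eq_or_lt with h | h
    · exfalso
      have h0 : g.edist hg y x₁ = 0 := by
        rw [hfe, show f x₁ = 0 from h.symm, ENNReal.ofReal_zero]
      rw [g.edist_eq_zero_iff hg] at h0
      rw [← h0] at hux₁
      linarith
    · exact h
  -- `u < m` on the open ball `B_R(y)`
  have hball : ∀ z, f z < R → u z < m := by
    intro z hz
    by_contra hle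
    rw [not_lt] at hle
    have h1 : f x₁ ≤ f z := hx₁min ⟨show f z ≤ f x₀ from (hz.le.trans hx₁f), hle⟩
    linarith
  -- the constants
  set A : ℝ := 3 + 3 * R * ((Module.finrank ℝ E : ℝ) - 1) * (Real.cosh (R / 4) / Real.sinh (R / 4))
    with hA
  set α : ℝ := A / R ^ 2 with hα_def
  have hαR : α * R ^ 2 = A := by rw [hα_def]; field_simp
  have hαA : A ≤ α * R ^ 2 := hαR.ge
  set c₀ : ℝ := α * Real.exp (-(α * (9 * R ^ 2 / 4))) with hc₀
  -- Hopf's bump and the lower-barrier property on the shell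
  set h : M → ℝ := fun z ↦ Real.exp (-(α * f z ^ 2)) - Real.exp (-(α * R ^ 2)) with hh
  have hhcont : Continuous h := by rw [hh]; fun_prop
  have hh1 : ∀ z, h z ≤ 1 := fun z ↦ by
    have h1 : Real.exp (-(α * f z ^ 2)) ≤ 1 := by
      rw [← Real.exp_zero]; refine Real.exp_le_exp.2 ?_
      have hm1 : (0 : ℝ) ≤ (Module.finrank ℝ E : ℝ) - 1 := by
        obtain ⟨u₀, -, hu₀, -, -, -⟩ := exists_unit_speed_expMap_eq_of_ne g hg hc
          (show x₁ ≠ y from fun h ↦ by rw [h] at hux₁; linarith)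
        have hu₀0 : (u₀ : E) ≠ 0 := fun h ↦ by rw [h, map_zero] at hu₀; exact zero_ne_one hu₀
        have h1 : 0 < Module.finrank ℝ E := Module.finrank_pos_iff_exists_ne_zero.2 ⟨u₀, hu₀0⟩
        have : (1 : ℝ) ≤ (Module.finrank ℝ E : ℝ) := by exact_mod_cast h1
        linarith
      have hA0 : 0 ≤ A := by
        rw [hA]
        have : 0 ≤ Real.cosh (R / 4) / Real.sinh (R / 4) :=
          div_nonneg (Real.cosh_pos _).le (Real.sinh_nonneg_iff.2 (by linarith))
        positivity
      have hα0 : 0 ≤ α := by rw [hα_def]; positivity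
      nlinarith [sq_nonneg (f z)]
    have h2 : 0 ≤ Real.exp (-(α * R ^ 2)) := (Real.exp_pos _).le
    show Real.exp (-(α * f z ^ 2)) - Real.exp (-(α * R ^ 2)) ≤ 1
    linarith
  have hhR : ∀ z, f z = R → h z = 0 := fun z hz ↦ by
    show Real.exp (-(α * f z ^ 2)) - Real.exp (-(α * R ^ 2)) = 0
    rw [hz, sub_self]
  have hα0 : 0 < α := by
    rw [hα_def]
    refine div_pos ?_ (by positivity)
    rw [hA]
    have hm1 : (0 : ℝ) ≤ (Module.finrank ℝ E : ℝ) - 1 := by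
      obtain ⟨u₀, -, hu₀, -, -, -⟩ := exists_unit_speed_expMap_eq_of_ne g hg hc
        (show x₁ ≠ y from fun h ↦ by rw [h] at hux₁; linarith)
      have hu₀0 : (u₀ : E) ≠ 0 := fun h ↦ by rw [h, map_zero] at hu₀; exact zero_ne_one hu₀
      have h1 : 0 < Module.finrank ℝ E := Module.finrank_pos_iff_exists_ne_zero.2 ⟨u₀, hu₀0⟩
      have : (1 : ℝ) ≤ (Module.finrank ℝ E : ℝ) := by exact_mod_cast h1
      linarith
    have : 0 ≤ Real.cosh (R / 4) / Real.sinh (R / 4) :=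
      div_nonneg (Real.cosh_pos _).le (Real.sinh_nonneg_iff.2 (by linarith))
    positivity
  have hhneg : ∀ z, R < f z → h z < 0 := fun z hz ↦ by
    show Real.exp (-(α * f z ^ 2)) - Real.exp (-(α * R ^ 2)) < 0
    have : Real.exp (-(α * f z ^ 2)) < Real.exp (-(α * R ^ 2)) := by
      refine Real.exp_lt_exp.2 ?_
      have h1 : R ^ 2 < f z ^ 2 := by nlinarith
      nlinarith [mul_lt_mul_of_pos_left h1 hα0]
    linarith
  have hc₀0 : 0 < c₀ := mul_pos hα0 (Real.exp_pos _)
  -- `θ`: `u ≤ m - θ` on the closed ball of radius `R/2`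
  obtain ⟨zθ, hzθ, hzθmax⟩ := (hcpt (R / 2)).exists_isMaxOn ⟨y, show f y ≤ R / 2 by
    rw [hf_def]; simp only [PseudoRiemannianMetric.edist_self, ENNReal.toReal_zero]; linarith⟩
    hucont.continuousOn
  set θ : ℝ := m - u zθ with hθ
  have hθ0 : 0 < θ := by
    have := hball zθ (by simp only [mem_setOf_eq] at hzθ; linarith)
    rw [hθ]; linarith
  have hθin : ∀ z, f z ≤ R / 2 → u z ≤ m - θ := fun z hz ↦ by
    have h1 : u z ≤ u zθ := hzθmax hz
    rw [hθ]; linarith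
  set δ : ℝ := θ / 2 with hδ
  have hδ0 : 0 < δ := by positivity
  set w : M → ℝ := fun z ↦ u z + δ * h z with hw_def
  have hwcont : Continuous w := hucont.add (continuous_const.mul hhcont)
  -- KEY: `w` is a strict viscosity subsolution on the shell `R/2 ≤ f ≤ 3R/2`
  have hkey : ∀ x, R / 2 ≤ f x → f x ≤ 3 * R / 2 → ∀ φ : M → ℝ,
      (∀ᶠ x' in 𝓝 x, ContMDiffAt 𝓘(ℝ, E) 𝓘(ℝ, ℝ) 2 φ x') →
      IsLocalMax (fun x' ↦ w x' - φ x') x → δ * c₀ ≤ g.laplaceBeltrami φ x := by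
    intro x hx1 hx2 φ hφ hlm
    obtain ⟨ψ, hψs, hψle, hψx, hψΔ⟩ :=
      exists_lower_barrier_hopf_bump g hg hc hRic y hR hαA hx1 hx2
    -- `φ - δ ψ` touches `u` from above at `x`
    have hφ₂s : ∀ᶠ x' in 𝓝 x, ContMDiffAt 𝓘(ℝ, E) 𝓘(ℝ, ℝ) 2 (fun z ↦ φ z + (-δ) * ψ z) x' := by
      filter_upwards [hφ, hψs] with x' h1 h2
      exact h1.add (contMDiffAt_const.mul h2)
    have hlm₂ : IsLocalMax (fun x' ↦ u x' - (φ x' + (-δ) * ψ x')) x := by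
      filter_upwards [hlm] with z hz
      have h1 := hψle z
      have h2 : h x = Real.exp (-(α * f x ^ 2)) - Real.exp (-(α * R ^ 2)) := rfl
      have h3 : h z = Real.exp (-(α * f z ^ 2)) - Real.exp (-(α * R ^ 2)) := rfl
      have hz' : u z + δ * h z - φ z ≤ u x + δ * h x - φ x := hz
      rw [← h3] at h1
      rw [← h2] at hψx
      nlinarith [mul_le_mul_of_nonneg_left h1 hδ0.le]
    have h0 := hsub x _ hφ₂s hlm₂
    rw [laplaceBeltrami_eq_dalembertian,
      g.dalembertian_add_const_mul_of_contMDiffAt hφ.self_of_nhds hψs.self_of_nhds,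
      ← laplaceBeltrami_eq_dalembertian, ← laplaceBeltrami_eq_dalembertian] at h0
    nlinarith [mul_le_mul_of_nonneg_left hψΔ hδ0.le]
  -- the barrier maximum principle on `K = {R/2 ≤ f ≤ R}`
  set K : Set M := {z | R / 2 ≤ f z ∧ f z ≤ R} with hK
  set Ω : Set M := {z | R / 2 < f z ∧ f z < R} with hΩ
  have hKc : IsCompact K :=
    (hcpt R).of_isClosed_subset ((isClosed_le continuous_const hfcont).inter
      (isClosed_le hfcont continuous_const)) fun z hz ↦ hz.2
  have hΩo : IsOpen Ω := (isOpen_lt continuous_const hfcont).inter (isOpen_lt hfcont continuous_const)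
  have hΩK : Ω ⊆ K := fun z hz ↦ ⟨hz.1.le, hz.2.le⟩
  have hmp := le_of_upper_barriers g hKc hΩK hΩo (u := fun _ ↦ m) (w := w) (F := fun _ ↦ 0)
    (G := fun _ ↦ δ * c₀)
    ((hwcont.sub continuous_const).upperSemicontinuous.upperSemicontinuousOn K)
    (by
      rintro x ⟨hxK, hxΩ⟩
      simp only [hΩ, mem_setOf_eq, not_and_or, not_lt] at hxΩ
      show u x + δ * h x ≤ m
      rcases hxΩ with h1 | h1
      · have h2 : f x ≤ R / 2 := h1
        have := hθin x h2
        have := hh1 x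
        nlinarith
      · have h2 : f x = R := le_antisymm hxK.2 h1
        rw [hhR x h2, mul_zero, add_zero]; exact hmax x)
    (by
      intro x _ ε hε
      refine ⟨fun _ ↦ m, Eventually.of_forall fun _ ↦ contMDiffAt_const, ?_, ?_⟩
      · exact Eventually.of_forall fun _ ↦ by simp
      · rw [laplaceBeltrami_const']; linarith)
    (fun x hx φ hφ hlm ↦ hkey x hx.1.le (by linarith [hx.2]) φ hφ hlm)
    (fun x _ ↦ mul_pos hδ0 hc₀0)
  -- `w ≤ m` near `x₁`, `w x₁ = m`
  have hwx₁ : w x₁ = m := by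
    show u x₁ + δ * h x₁ = m
    rw [hhR x₁ rfl, mul_zero, add_zero, hux₁]
  have hlmx₁ : IsLocalMax (fun x' ↦ w x' - m) x₁ := by
    have hU : {z | R / 2 < f z} ∈ 𝓝 x₁ :=
      (isOpen_lt continuous_const hfcont).mem_nhds (show R / 2 < f x₁ by rw [← hR_def]; linarith)
    filter_upwards [hU] with z hz
    rw [hwx₁, sub_self, sub_nonpos]
    rcases le_or_gt (f z) R with h1 | h1
    · exact hmp z ⟨hz.le, h1⟩
    · have := hhneg z h1
      show u z + δ * h z ≤ m
      nlinarith [hmax z]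
  have hfin := hkey x₁ (by rw [← hR_def]; linarith) (by rw [← hR_def]; linarith) (fun _ ↦ m)
    (Eventually.of_forall fun _ ↦ contMDiffAt_const) hlmx₁
  rw [laplaceBeltrami_const'] at hfin
  linarith [mul_pos hδ0 hc₀0]

end SMP

end Literature.Geometry.Riemannian

end
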